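import Summits.AtomisticToContinuum.BoseEinsteinCondensation.Theorems.BECCutLineWeakDisorderWitnessTransferRatio
import Literature.MathematicalPhysics.QuantumManyBody.GroundStateFeynmanKacWitnessBoundary
import Literature.MathematicalPhysics.QuantumManyBody.GroundStateFeynmanKacFreeForm
import HarnessLib

/-!
# Route BECCutLineWeakDisorder — `WitnessTransfer`, line `Sketch`: walls and level-set truncation

Support file (does not close the item) for the crux stmt-AtomisticToContinuum-14978
(`Summit.AtomisticToContinuum.BoseEinsteinCondensation.Theses.BECCutLineWeakDisorder.WitnessTransfer`),
feeding the glue `stub_landscape_of_parts` of the registered skeleton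
(`Cruxes/WitnessTransfer/Lines/Sketch.lean`):

* `glue_wall_vanish` — the partition function `e^{-TH_N}1` vanishes uniformly at the walls of
  the box (survival needs one Brownian coordinate to stay in a half-line: small-ball bound for the
  running maximum, `measure_forall_lt_le_of_isPreBrownianReal`);
* `glue_sqIncr_posPart_sub_le` — the level-set truncation `f ↦ (f − η)₊` is a contraction for the
  Gaussian increment `sqIncr`;
* `glue_tendsto_integral_posPart_sq`, `glue_tendsto_ratio_posPart` — `∫ (f−η)₊² → ∫ f²` and the
  landscape ratio `R_L((f−η)₊) → R_L(f)` as `η → 0+`.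
-/

noncomputable section

open MeasureTheory Filter Set Metric
open scoped ENNReal NNReal Topology

namespace Summit.AtomisticToContinuum.BoseEinsteinCondensation.Theorems.CutLineWitness

open Literature.MathematicalPhysics.QuantumManyBody.BoseGas
open Literature.Probability.Process

/-! ### The walls -/

/-- **The partition function vanishes uniformly at the walls.** For `T > 0` and `η > 0` there is
`κ > 0` such that `(e^{-TH_N}1)(X) ≤ η` whenever some coordinate `X_{ik}` is `< κ` or `> L − κ`
(the world-line coordinate `X_{ik} + √2 b` must stay in `(0, L)` up to time `T`: small-ball bound
for the one-sided running maximum of a Brownian coordinate). [folklore] -/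
theorem glue_wall_vanish {N : ℕ} (v : ℝ → ℝ≥0∞) (L : ℝ) {T : ℝ} (hT : 0 < T) {η : ℝ} (hη : 0 < η) :
    ∃ κ : ℝ, 0 < κ ∧ ∀ X : Config N, (∃ i k, X i k < κ ∨ L - κ < X i k) →
      fkSemigroup v L T (fun _ => (1 : ℝ≥0∞)) X ≤ ENNReal.ofReal η := by
  have hsT : 0 < Real.sqrt T := Real.sqrt_pos.2 hT
  set κ : ℝ := min (Real.sqrt T) (η ^ 2 * Real.sqrt T / 4) with hκdef
  have hκ : 0 < κ := lt_min hsT (by positivity)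
  have hκT : κ ≤ Real.sqrt T := min_le_left _ _
  have hκη : κ ≤ η ^ 2 * Real.sqrt T / 4 := min_le_right _ _
  have hs2 : 1 ≤ Real.sqrt 2 := by
    rw [Real.le_sqrt (by norm_num) (by norm_num)]; norm_num
  have hs2pos : 0 < Real.sqrt 2 := one_pos.trans_le hs2
  set Tn : ℝ≥0 := T.toNNReal with hTn
  have hTn0 : 0 < Tn := Real.toNNReal_pos.2 hT
  have hTncoe : ((Tn : ℝ≥0) : ℝ) = T := Real.coe_toNNReal T hT.le
  -- the common bound: for `0 < a < κ`, `P(∀ r ≤ T, B_r < a/√2) ≤ η`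
  have hbound : ∀ {a : ℝ}, 0 < a → a < κ →
      ENNReal.ofReal (2 * Real.sqrt (a / Real.sqrt 2 / Real.sqrt Tn)) ≤ ENNReal.ofReal η ∧
      0 < a / Real.sqrt 2 ∧ a / Real.sqrt 2 ≤ Real.sqrt Tn := by
    intro a ha haκ
    rw [hTncoe]
    have h1 : a / Real.sqrt 2 ≤ a := div_le_self ha.le hs2
    refine ⟨ENNReal.ofReal_le_ofReal ?_, div_pos ha hs2pos, h1.trans (haκ.le.trans hκT)⟩
    have h2 : a / Real.sqrt 2 / Real.sqrt T ≤ η ^ 2 / 4 := by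
      rw [div_le_iff₀ hsT]
      calc a / Real.sqrt 2 ≤ a := h1
        _ ≤ η ^ 2 * Real.sqrt T / 4 := haκ.le.trans hκη
        _ = η ^ 2 / 4 * Real.sqrt T := by ring
    calc 2 * Real.sqrt (a / Real.sqrt 2 / Real.sqrt T) ≤ 2 * Real.sqrt (η ^ 2 / 4) := by
          gcongr
      _ = η := by
          rw [show η ^ 2 / 4 = (η / 2) ^ 2 by ring, Real.sqrt_sq (by positivity)]; ring
  refine ⟨κ, hκ, fun X hX => ?_⟩
  -- off the box the functional vanishes
  by_cases hXbox : X ∈ boxN N L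
  swap
  · rw [fkSemigroup_of_notMem v hT.le _ hXbox]; exact zero_le
  obtain ⟨i, k, hik⟩ := hX
  have hsurv : fkSemigroup v L T (fun _ => (1 : ℝ≥0∞)) X ≤ wienerPaths N (survives L T X) := by
    unfold fkSemigroup
    simp only [mul_one]
    exact lintegral_fkWeight_le_measure_survives v L T X
  refine hsurv.trans ?_
  rcases hik with hlt | hlt
  · -- near the lower face
    have hpos : 0 < X i k := (hXbox i k).1
    obtain ⟨hb, hm, hms⟩ := hbound hpos hlt
    have hneg : ProbabilityTheory.IsPreBrownianReal (-brownian) preWienerMeasure :=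
      Literature.Probability.RandomPlanarGeometry.isPreBrownianReal_brownian.neg
    exact (measure_survives_le_lower hT.le X i k).trans
      ((measure_forall_lt_le_of_isPreBrownianReal hneg (fun t => (measurable_brownian t).neg)
        (fun η => (continuous_brownian η).neg) hTn0 hm hms).trans hb)
  · -- near the upper face
    have hpos : 0 < L - X i k := by linarith [(hXbox i k).2]
    have hlt' : L - X i k < κ := by linarith
    obtain ⟨hb, hm, hms⟩ := hbound hpos hlt'
    exact (measure_survives_le_upper hT.le X i k).trans
      ((measure_forall_lt_le_of_isPreBrownianReal
        Literature.Probability.RandomPlanarGeometry.isPreBrownianReal_brownian measurable_brownian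
        continuous_brownian hTn0 hm hms).trans hb)

/-- **Level-set truncation is a contraction for the Gaussian increment**:
`sqIncr t (f − η)₊ ≤ sqIncr t f` (`|(a−η)₊ − (b−η)₊| ≤ |a − b|` pointwise). [folklore] -/
theorem glue_sqIncr_posPart_sub_le {N : ℕ} (f : Config N → ℝ) (η : ℝ) (t : ℝ≥0) :
    sqIncr t (fun X => max (f X - η) 0) ≤ sqIncr t f := by
  refine lintegral_mono fun ω => lintegral_mono fun X => ENNReal.ofReal_le_ofReal ?_
  have h := abs_max_sub_max_le_abs (f (X + displacement t ω) - η) (f X - η) 0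
  rw [sub_sub_sub_cancel_right] at h
  calc (max (f (X + displacement t ω) - η) 0 - max (f X - η) 0) ^ 2
      = |max (f (X + displacement t ω) - η) 0 - max (f X - η) 0| ^ 2 := (sq_abs _).symm
    _ ≤ |f (X + displacement t ω) - f X| ^ 2 := pow_le_pow_left₀ (abs_nonneg _) h 2
    _ = (f (X + displacement t ω) - f X) ^ 2 := sq_abs _

/-- **`∫ (f − η)₊² → ∫ f²` as `η → 0+`** for a bounded measurable `f ≥ 0` vanishing off the box
(dominated convergence). [folklore] -/
theorem glue_tendsto_integral_posPart_sq {N : ℕ} {L : ℝ} {f : Config N → ℝ} (hfm : Measurable f)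
    {M : ℝ} (hM : ∀ X, |f X| ≤ M) (hnn : ∀ X, 0 ≤ f X) (h0 : ∀ X, X ∉ boxN N L → f X = 0) :
    Tendsto (fun η : ℝ => ∫ X, (max (f X - η) 0) ^ 2) (𝓝[>] 0) (𝓝 (∫ X, f X ^ 2)) := by
  have hgm : ∀ η : ℝ, Measurable fun X => max (f X - η) 0 := fun η =>
    (hfm.sub measurable_const).max measurable_const
  refine tendsto_integral_filter_of_dominated_convergence
    ((boxN N L).indicator fun _ => M ^ 2) ?_ ?_ ?_ ?_
  · exact Eventually.of_forall fun η => ((hgm η).pow_const 2).aestronglyMeasurable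
  · filter_upwards [self_mem_nhdsWithin] with η hη
    refine Eventually.of_forall fun X => ?_
    have hη' : (0 : ℝ) < η := hη
    rw [Real.norm_eq_abs, abs_of_nonneg (sq_nonneg _)]
    by_cases hX : X ∈ boxN N L
    · rw [Set.indicator_of_mem hX]
      have h1 : max (f X - η) 0 ≤ f X := max_le (by linarith [hnn X]) (hnn X)
      have h2 : f X ≤ M := (le_abs_self _).trans (hM X)
      exact pow_le_pow_left₀ (le_max_right _ _) (h1.trans h2) 2
    · rw [Set.indicator_of_notMem hX, h0 X hX, max_eq_right (by linarith)]
      simp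
  · exact (integrableOn_const (volume_boxN_lt_top N L).ne).integrable_indicator (measurableSet_boxN N L)
  · refine Eventually.of_forall fun X => ?_
    have hc : Continuous fun η : ℝ => (max (f X - η) 0) ^ 2 := by fun_prop
    have h := (hc.tendsto 0).mono_left (nhdsWithin_le_nhds (s := Set.Ioi (0 : ℝ)))
    simpa [max_eq_left (hnn X)] using h

/-- **The landscape ratio of the truncations converges**: `R_L((f − η)₊) → R_L(f)` as `η → 0+`
for a bounded measurable `f ≥ 0` vanishing off `Λ_L^{n+1}` (dominated convergence for the ratio;
at slices where `f` vanishes a.e. so does `(f − η)₊ ≤ f`, and the integrand is `0` throughout).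
[folklore] -/
theorem glue_tendsto_ratio_posPart {n : ℕ} {L : ℝ} {f : Config (n + 1) → ℝ} (hfm : Measurable f)
    {M : ℝ} (hM : ∀ X, |f X| ≤ M) (hnn : ∀ X, 0 ≤ f X) (h0 : ∀ X, X ∉ boxN (n + 1) L → f X = 0) :
    Tendsto (fun η : ℝ => ∫⁻ Y : Config n, ENNReal.ofReal (L ^ 3) *
        (∫⁻ x, (‖max (f (Matrix.vecCons x Y) - η) 0‖₊ : ℝ≥0∞) ^ 2) ^ 2 /
          (∫⁻ x, (‖max (f (Matrix.vecCons x Y) - η) 0‖₊ : ℝ≥0∞)) ^ 2) (𝓝[>] 0)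
      (𝓝 (∫⁻ Y : Config n, ENNReal.ofReal (L ^ 3) *
        (∫⁻ x, (‖f (Matrix.vecCons x Y)‖₊ : ℝ≥0∞) ^ 2) ^ 2 /
          (∫⁻ x, (‖f (Matrix.vecCons x Y)‖₊ : ℝ≥0∞)) ^ 2)) := by
  -- replace `η` by `max η 0` (the same family on `η > 0`)
  set G : ℝ → Config (n + 1) → ℝ := fun η X => max (f X - max η 0) 0 with hGdef
  have hGm : ∀ η, Measurable (G η) := fun η => (hfm.sub measurable_const).max measurable_const
  have hGle : ∀ η X, G η X ≤ f X := fun η X =>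
    max_le (by linarith [hnn X, le_max_right η 0]) (hnn X)
  have hGnn : ∀ η X, 0 ≤ G η X := fun η X => le_max_right _ _
  have hGbd : ∀ η X, |G η X| ≤ M := fun η X => by
    rw [abs_of_nonneg (hGnn η X)]; exact (hGle η X).trans ((le_abs_self _).trans (hM X))
  have hG0 : ∀ η X, X ∉ boxN (n + 1) L → G η X = 0 := fun η X hX => by
    show max (f X - max η 0) 0 = 0
    rw [h0 X hX, max_eq_right (by linarith [le_max_right η 0])]
  have hGlim : ∀ X, Tendsto (fun η => G η X) (𝓝[>] 0) (𝓝 (f X)) := fun X => by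
    have hc : Continuous fun η : ℝ => max (f X - max η 0) 0 := by fun_prop
    have h := (hc.tendsto 0).mono_left (nhdsWithin_le_nhds (s := Set.Ioi (0 : ℝ)))
    simpa [hGdef, max_eq_left (hnn X)] using h
  have heq : (fun η : ℝ => ∫⁻ Y : Config n, ENNReal.ofReal (L ^ 3) *
      (∫⁻ x, (‖max (f (Matrix.vecCons x Y) - η) 0‖₊ : ℝ≥0∞) ^ 2) ^ 2 /
        (∫⁻ x, (‖max (f (Matrix.vecCons x Y) - η) 0‖₊ : ℝ≥0∞)) ^ 2) =ᶠ[𝓝[>] 0]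
      fun η => ∫⁻ Y : Config n, ENNReal.ofReal (L ^ 3) *
        (∫⁻ x, (‖G η (Matrix.vecCons x Y)‖₊ : ℝ≥0∞) ^ 2) ^ 2 /
          (∫⁻ x, (‖G η (Matrix.vecCons x Y)‖₊ : ℝ≥0∞)) ^ 2 := by
    filter_upwards [self_mem_nhdsWithin] with η hη
    have hη' : max η 0 = η := max_eq_left (le_of_lt hη)
    simp only [hGdef, hη']
  refine Tendsto.congr' heq.symm ?_
  refine tendsto_lintegral_ratio hGm hGbd hG0 (Eventually.of_forall fun Y => ?_)
  by_cases hpos : 0 < ∫⁻ x, (‖f (Matrix.vecCons x Y)‖₊ : ℝ≥0∞)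
  · exact tendsto_ratioIntegrand hGm hGbd hG0 hGlim hpos
  · -- a slice where `f` vanishes a.e.: everything is `0`
    rw [not_lt, le_zero_iff] at hpos
    have hae : ∀ᵐ x ∂(volume : Measure Space), f (Matrix.vecCons x Y) = 0 := by
      have h1 := (lintegral_eq_zero_iff (measurable_slice hfm Y).nnnorm.coe_nnreal_ennreal).1 hpos
      filter_upwards [h1] with x hx
      simpa using hx
    have hm0 : ∫⁻ x, (‖f (Matrix.vecCons x Y)‖₊ : ℝ≥0∞) ^ 2 = 0 := by
      rw [lintegral_eq_zero_iff ((measurable_slice hfm Y).nnnorm.coe_nnreal_ennreal.pow_const 2)]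
      filter_upwards [hae] with x hx
      simp [hx]
    have hGae : ∀ η, ∀ᵐ x ∂(volume : Measure Space), G η (Matrix.vecCons x Y) = 0 := fun η => by
      filter_upwards [hae] with x hx
      exact le_antisymm (by rw [← hx]; exact hGle η _) (hGnn η _)
    have hGs : ∀ η, ∫⁻ x, (‖G η (Matrix.vecCons x Y)‖₊ : ℝ≥0∞) = 0 := fun η => by
      rw [lintegral_eq_zero_iff (measurable_slice (hGm η) Y).nnnorm.coe_nnreal_ennreal]
      filter_upwards [hGae η] with x hx
      simp [hx]
    have hGm0 : ∀ η, ∫⁻ x, (‖G η (Matrix.vecCons x Y)‖₊ : ℝ≥0∞) ^ 2 = 0 := fun η => by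
      rw [lintegral_eq_zero_iff ((measurable_slice (hGm η) Y).nnnorm.coe_nnreal_ennreal.pow_const 2)]
      filter_upwards [hGae η] with x hx
      simp [hx]
    simp only [hpos, hm0, hGs, hGm0]
    exact tendsto_const_nhds


end Summit.AtomisticToContinuum.BoseEinsteinCondensation.Theorems.CutLineWitness

end
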